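import Mathlib
import Summits.KontsevichZagierPeriods.KontsevichZagierPeriods.Theorems.SoloInformedBlockReps
import Summits.KontsevichZagierPeriods.KontsevichZagierPeriods.Theorems.SoloInformedHarmonicGQ
import HarnessLib
import HarnessLib.Audit

/-!
# SoloInformed — placing one more coordinate into a block labelling (hook identities, file F1b)

Solo programme `solo-KontsevichZagierPeriods-informed`, session s51 (PROGRAMME LIII).

The `B`-side of the ITERATED scale band step for the hook identities
(Kaneko–Yamamoto's integral–series identity for `l = (1,…,1)`) places the hanging variables
`b_i, b_{i-1}, …, b_1` one at a time into the chain of `ζ(u)`: each new coordinate `b` is either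
MERGED into an existing block `c` (`soloInformedPlMerge β b c = β[b ↦ c]`) or INSERTED as a new
block right after block `c` (`soloInformedPlIns β b c`: labels `> c` shift up by one, `b ↦ c+1`).
Coordinates not yet placed carry a label `> K` (`K + 1` = current number of blocks) and are
invisible to the fibres `fib_t`, `t ≤ K`, and to the chain products `Q_t(w) = ∏_{β l ≤ t} w_l`.

This file is the bookkeeping of ONE such step for an ARBITRARY labelling `β` (file
`SoloInformedHoffmanLabels` did it for the `u`-labelling only): fibres (`_fib_plMerge/_plIns`),
chain products (`_BP_plMerge/_plIns`) and their lists — `merge_c(w_b; Q)` and `ins_{c+1}(w_b; Q)` of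
`SoloInformedHarmonicGQ` (`_ofFn_BP_plMerge/_plIns`) —, indices (block `c` raised by one / a letter
`1` inserted after block `c`: `_idx_plMerge/_plIns`), the partial validity predicate
`soloInformedIsLabK` and the placed count `cum_K` (each step places exactly one coordinate;
when all `N` are placed the labelling is valid, `_isLab_of_cum_eq`).

Place in PROGRAMME LIII (the files that consume this one): `SoloInformedHookPlace` (the placement
sums over all merge/insert choices), then `SoloInformedHookStates`, `SoloInformedHookPoly`,
`SoloInformedHookStage`, `SoloInformedHookChain`, `SoloInformedHookB` (the `B`-side class of the
iterated scale band step) and finally `SoloInformedHook` (the hook identities in `𝒫`).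

References: M. Kaneko, S. Yamamoto, arXiv:1605.03117, Thm 4.1, Prop. 5.4; M. Hoffman, Pacific J.
Math. 152 (1992) §2; Kontsevich–Zagier 2001 §1.2 [KontsevichZagier2001].
-/

noncomputable section

open Literature.NumberTheory.Transcendental
open Literature.NumberTheory.Transcendental.KZ

namespace Summit.KontsevichZagierPeriods.KontsevichZagierPeriods.Theorems

section place

variable {N : ℕ} (β : Fin N → ℕ) (b : Fin N) (c : ℕ)

/-- MERGE the coordinate `b` into block `c`. -/
def soloInformedPlMerge : Fin N → ℕ := Function.update β b c

/-- INSERT the coordinate `b` as a new block after block `c` (the new block has index `c + 1`,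
the old blocks `> c` shift up by one). -/
def soloInformedPlIns : Fin N → ℕ :=
  Function.update (fun l => if β l ≤ c then β l else β l + 1) b (c + 1)

/-- The merged coordinate gets label `c`. -/
@[simp] theorem soloInformedPlMerge_self : soloInformedPlMerge β b c b = c := by
  simp [soloInformedPlMerge]

/-- Merging does not move the other coordinates. -/
theorem soloInformedPlMerge_of_ne {l : Fin N} (hl : l ≠ b) : soloInformedPlMerge β b c l = β l := by
  simp [soloInformedPlMerge, Function.update_of_ne hl]

/-- The inserted coordinate gets label `c + 1`. -/
@[simp] theorem soloInformedPlIns_self : soloInformedPlIns β b c b = c + 1 := by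
  simp [soloInformedPlIns]

/-- Inserting shifts the labels `> c` of the other coordinates up by one. -/
theorem soloInformedPlIns_of_ne {l : Fin N} (hl : l ≠ b) :
    soloInformedPlIns β b c l = if β l ≤ c then β l else β l + 1 := by
  simp [soloInformedPlIns, Function.update_of_ne hl]

/-- Partial validity with blocks `0,…,K`: every block `t ≤ K` nonempty, block `0` of size `≥ 2`
(labels `> K` = coordinates not yet placed). -/
def soloInformedIsLabK (K : ℕ) : Prop :=
  (∀ t ≤ K, 1 ≤ soloInformedFib β t) ∧ 2 ≤ soloInformedFib β 0

variable {β b c} {K : ℕ} (hb : K < β b)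
include hb

/-! ### Merging -/

/-- **Fibres after merging** (`t ≤ K`): block `c` gains one element. -/
theorem soloInformed_fib_plMerge {t : ℕ} (ht : t ≤ K) :
    soloInformedFib (soloInformedPlMerge β b c) t =
      soloInformedFib β t + if t = c then 1 else 0 := by
  unfold soloInformedFib
  have hnot : b ∉ Finset.univ.filter (fun l : Fin N => β l = t) := by
    simp only [Finset.mem_filter, Finset.mem_univ, true_and]; omega
  split_ifs with htc
  · subst htc
    have hS : Finset.univ.filter (fun l : Fin N => soloInformedPlMerge β b t l = t) =
        insert b (Finset.univ.filter fun l : Fin N => β l = t) := by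
      ext l
      by_cases hl : l = b
      · subst hl; simp
      · simp [soloInformedPlMerge_of_ne β b t hl, hl]
    rw [hS, Finset.card_insert_of_notMem hnot]
  · rw [add_zero]
    congr 1
    ext l
    by_cases hl : l = b
    · subst hl
      simp only [Finset.mem_filter, Finset.mem_univ, true_and, soloInformedPlMerge_self]
      omega
    · simp [soloInformedPlMerge_of_ne β b c hl]

/-- **Chain products after merging** (`t ≤ K`): `Q_t` below `c`, `Q_t · w_b` from `c` on. -/
theorem soloInformed_BP_plMerge (w : Fin N → ℝ) {t : ℕ} (ht : t ≤ K) :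
    soloInformedBP (soloInformedPlMerge β b c) w t =
      if t < c then soloInformedBP β w t else soloInformedBP β w t * w b := by
  unfold soloInformedBP
  have hnot : b ∉ Finset.univ.filter (fun l : Fin N => β l ≤ t) := by
    simp only [Finset.mem_filter, Finset.mem_univ, true_and]; omega
  split_ifs with h1
  · congr 1
    ext l
    by_cases hl : l = b
    · subst hl
      simp only [Finset.mem_filter, Finset.mem_univ, true_and, soloInformedPlMerge_self]
      omega
    · simp [soloInformedPlMerge_of_ne β b c hl]
  · rw [mul_comm, ← Finset.prod_insert hnot]
    congr 1
    ext l
    by_cases hl : l = b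
    · subst hl
      simp only [Finset.mem_filter, Finset.mem_univ, true_and, soloInformedPlMerge_self,
        Finset.mem_insert, true_or, iff_true]
      omega
    · simp [soloInformedPlMerge_of_ne β b c hl, hl]

/-- The placed count grows by one under merging (`c ≤ K`). -/
theorem soloInformed_cum_plMerge (hc : c ≤ K) :
    soloInformedCum (soloInformedPlMerge β b c) K = soloInformedCum β K + 1 := by
  unfold soloInformedCum
  have hnot : b ∉ Finset.univ.filter (fun l : Fin N => β l ≤ K) := by
    simp only [Finset.mem_filter, Finset.mem_univ, true_and]; omega
  rw [← Finset.card_insert_of_notMem hnot]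
  congr 1
  ext l
  by_cases hl : l = b
  · subst hl
    simp only [Finset.mem_filter, Finset.mem_univ, true_and, soloInformedPlMerge_self,
      Finset.mem_insert, true_or, iff_true]
    exact hc
  · simp [soloInformedPlMerge_of_ne β b c hl, hl]

omit hb in
/-- Coordinates other than `b` that were not placed stay unplaced under merging. -/
theorem soloInformed_lt_plMerge_of_ne {l : Fin N} (hl : l ≠ b) (hK : K < β l) :
    K < soloInformedPlMerge β b c l := by
  rw [soloInformedPlMerge_of_ne β b c hl]; exact hK

/-- Partial validity is preserved by merging. -/
theorem soloInformed_isLabK_plMerge (hL : soloInformedIsLabK β K) :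
    soloInformedIsLabK (soloInformedPlMerge β b c) K := by
  refine ⟨fun t ht => ?_, ?_⟩
  · rw [soloInformed_fib_plMerge hb ht]
    have := hL.1 t ht
    omega
  · rw [soloInformed_fib_plMerge hb (Nat.zero_le K)]
    have := hL.2
    omega

/-- **The index after merging into block `c ≤ K`: entry `c` raised by one.** -/
theorem soloInformed_idx_plMerge (hc : c ≤ K) :
    soloInformedIdx (soloInformedPlMerge β b c) (K + 1) =
      (soloInformedIdx β (K + 1)).take c ++
        (soloInformedFib β c + 1) :: (soloInformedIdx β (K + 1)).drop (c + 1) := by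
  have hlen : ((soloInformedIdx β (K + 1)).take c).length = c := by
    rw [List.length_take, soloInformed_length_idx]; omega
  apply List.ext_getElem?
  intro t
  by_cases ht : t < K + 1
  · rw [List.getElem?_eq_getElem (by simpa using ht), soloInformed_idx_getElem,
      soloInformed_fib_plMerge hb (by omega : t ≤ K)]
    rcases lt_trichotomy t c with h1 | h1 | h1
    · rw [if_neg h1.ne, add_zero, List.getElem?_append_left (by omega), List.getElem?_take,
        if_pos h1,
        List.getElem?_eq_getElem (by simp only [soloInformed_length_idx]; omega),
        soloInformed_idx_getElem]
    · subst h1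
      rw [if_pos rfl, List.getElem?_append_right (by omega), hlen, Nat.sub_self,
        List.getElem?_cons_zero]
    · rw [if_neg h1.ne', add_zero, List.getElem?_append_right (by omega), hlen]
      obtain ⟨s, rfl⟩ : ∃ s, t = c + 1 + s := ⟨t - c - 1, by omega⟩
      rw [show c + 1 + s - c = s + 1 by omega, List.getElem?_cons_succ, List.getElem?_drop,
        List.getElem?_eq_getElem (by simp only [soloInformed_length_idx]; omega),
        soloInformed_idx_getElem]
  · rw [List.getElem?_eq_none (by simpa using ht), List.getElem?_eq_none (by
      simp only [List.length_append, List.length_cons, hlen, List.length_drop,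
        soloInformed_length_idx]; omega)]

/-- **The chain of the merged labelling is `merge_c(w_b; Q)`.** -/
theorem soloInformed_ofFn_BP_plMerge (w : Fin N → ℝ) :
    List.ofFn (fun t : Fin (K + 1) => soloInformedBP (soloInformedPlMerge β b c) w t) =
      soloInformedMergeQ (w b) (List.ofFn fun t : Fin (K + 1) => soloInformedBP β w t) c := by
  apply List.ext_getElem?
  intro r
  rw [List.getElem?_ofFn, soloInformed_getElem?_mergeQ, List.getElem?_ofFn]
  by_cases hr : r < K + 1
  · rw [dif_pos hr, dif_pos hr, soloInformed_BP_plMerge hb w (by omega : r ≤ K)]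
    split_ifs with h1
    · rfl
    · rfl
  · rw [dif_neg hr, dif_neg hr]
    split_ifs <;> rfl

/-! ### Inserting -/

/-- **Fibres after inserting after block `c ≤ K`** (`t ≤ K + 1`): `fib_t` below and at `c`,
`1` at `c + 1`, `fib_{t-1}` above. -/
theorem soloInformed_fib_plIns (hc : c ≤ K) {t : ℕ} (ht : t ≤ K + 1) :
    soloInformedFib (soloInformedPlIns β b c) t =
      if t ≤ c then soloInformedFib β t
        else if t = c + 1 then 1 else soloInformedFib β (t - 1) := by
  unfold soloInformedFib
  split_ifs with h1 h2
  · congr 1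
    ext l
    by_cases hl : l = b
    · subst hl
      simp only [Finset.mem_filter, Finset.mem_univ, true_and, soloInformedPlIns_self]
      omega
    · simp only [Finset.mem_filter, Finset.mem_univ, true_and, soloInformedPlIns_of_ne β b c hl]
      split_ifs with h3 <;> omega
  · subst h2
    refine Finset.card_eq_one.2 ⟨b, ?_⟩
    ext l
    by_cases hl : l = b
    · subst hl
      simp
    · simp only [Finset.mem_filter, Finset.mem_univ, true_and, soloInformedPlIns_of_ne β b c hl,
        Finset.mem_singleton, hl, iff_false]
      split_ifs with h3 <;> omega
  · congr 1
    ext l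
    by_cases hl : l = b
    · subst hl
      simp only [Finset.mem_filter, Finset.mem_univ, true_and, soloInformedPlIns_self]
      omega
    · simp only [Finset.mem_filter, Finset.mem_univ, true_and, soloInformedPlIns_of_ne β b c hl]
      split_ifs with h3 <;> omega

/-- **Chain products after inserting** (`t ≤ K + 1`): `Q_t` up to `c`, `Q_{t-1} · w_b` above. -/
theorem soloInformed_BP_plIns (hc : c ≤ K) (w : Fin N → ℝ) {t : ℕ} (ht : t ≤ K + 1) :
    soloInformedBP (soloInformedPlIns β b c) w t =
      if t ≤ c then soloInformedBP β w t else soloInformedBP β w (t - 1) * w b := by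
  unfold soloInformedBP
  split_ifs with h1
  · congr 1
    ext l
    by_cases hl : l = b
    · subst hl
      simp only [Finset.mem_filter, Finset.mem_univ, true_and, soloInformedPlIns_self]
      omega
    · simp only [Finset.mem_filter, Finset.mem_univ, true_and, soloInformedPlIns_of_ne β b c hl]
      split_ifs with h3 <;> omega
  · have hnot : b ∉ Finset.univ.filter (fun l : Fin N => β l ≤ t - 1) := by
      simp only [Finset.mem_filter, Finset.mem_univ, true_and]; omega
    rw [mul_comm, ← Finset.prod_insert hnot]
    congr 1
    ext l
    by_cases hl : l = b
    · subst hl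
      simp only [Finset.mem_filter, Finset.mem_univ, true_and, soloInformedPlIns_self,
        Finset.mem_insert, true_or, iff_true]
      omega
    · simp only [Finset.mem_filter, Finset.mem_univ, true_and, soloInformedPlIns_of_ne β b c hl,
        Finset.mem_insert, hl, false_or]
      split_ifs with h3 <;> omega

/-- The placed count grows by one under inserting (`c ≤ K`; now `K + 2` blocks). -/
theorem soloInformed_cum_plIns (hc : c ≤ K) :
    soloInformedCum (soloInformedPlIns β b c) (K + 1) = soloInformedCum β K + 1 := by
  unfold soloInformedCum
  have hnot : b ∉ Finset.univ.filter (fun l : Fin N => β l ≤ K) := by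
    simp only [Finset.mem_filter, Finset.mem_univ, true_and]; omega
  rw [← Finset.card_insert_of_notMem hnot]
  congr 1
  ext l
  by_cases hl : l = b
  · subst hl
    simp only [Finset.mem_filter, Finset.mem_univ, true_and, soloInformedPlIns_self,
      Finset.mem_insert, true_or, iff_true]
    omega
  · simp only [Finset.mem_filter, Finset.mem_univ, true_and, soloInformedPlIns_of_ne β b c hl,
      Finset.mem_insert, hl, false_or]
    split_ifs with h3 <;> omega

omit hb in
/-- Coordinates other than `b` that were not placed stay unplaced under inserting. -/
theorem soloInformed_lt_plIns_of_ne (hc : c ≤ K) {l : Fin N} (hl : l ≠ b) (hK : K < β l) :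
    K + 1 < soloInformedPlIns β b c l := by
  rw [soloInformedPlIns_of_ne β b c hl]
  split_ifs with h <;> omega

/-- Partial validity is preserved by inserting after a block `c ≤ K` (now blocks `0,…,K+1`). -/
theorem soloInformed_isLabK_plIns (hL : soloInformedIsLabK β K) (hc : c ≤ K) :
    soloInformedIsLabK (soloInformedPlIns β b c) (K + 1) := by
  refine ⟨fun t ht => ?_, ?_⟩
  · rw [soloInformed_fib_plIns hb hc ht]
    split_ifs with h1 h2
    · exact hL.1 t (by omega)
    · exact le_rfl
    · exact hL.1 (t - 1) (by omega)
  · rw [soloInformed_fib_plIns hb hc (Nat.zero_le _), if_pos (Nat.zero_le c)]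
    exact hL.2

/-- **The index after inserting after block `c ≤ K`: a letter `1` inserted at position `c + 1`.** -/
theorem soloInformed_idx_plIns (hc : c ≤ K) :
    soloInformedIdx (soloInformedPlIns β b c) (K + 2) =
      (soloInformedIdx β (K + 1)).take (c + 1) ++
        1 :: (soloInformedIdx β (K + 1)).drop (c + 1) := by
  have hlen : ((soloInformedIdx β (K + 1)).take (c + 1)).length = c + 1 := by
    rw [List.length_take, soloInformed_length_idx]; omega
  apply List.ext_getElem?
  intro t
  by_cases ht : t < K + 2
  · rw [List.getElem?_eq_getElem (by simpa using ht), soloInformed_idx_getElem,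
      soloInformed_fib_plIns hb hc (by omega : t ≤ K + 1)]
    split_ifs with h1 h2
    · rw [List.getElem?_append_left (by omega), List.getElem?_take, if_pos (by omega),
        List.getElem?_eq_getElem (by simp only [soloInformed_length_idx]; omega),
        soloInformed_idx_getElem]
    · subst h2
      rw [List.getElem?_append_right (by omega), hlen, Nat.sub_self, List.getElem?_cons_zero]
    · rw [List.getElem?_append_right (by omega), hlen]
      obtain ⟨s, rfl⟩ : ∃ s, t = c + 2 + s := ⟨t - c - 2, by omega⟩
      rw [show c + 2 + s - (c + 1) = s + 1 by omega, List.getElem?_cons_succ, List.getElem?_drop,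
        List.getElem?_eq_getElem (by simp only [soloInformed_length_idx]; omega),
        soloInformed_idx_getElem, show c + 2 + s - 1 = c + 1 + s by omega]
  · rw [List.getElem?_eq_none (by simpa using ht), List.getElem?_eq_none (by
      simp only [List.length_append, List.length_cons, hlen, List.length_drop,
        soloInformed_length_idx]; omega)]

/-- **The chain of the inserted labelling is `ins_{c+1}(w_b; Q)`** (`c ≤ K`; the empty-prefix
value `p` of `ins` is irrelevant for a positive insertion position). -/
theorem soloInformed_ofFn_BP_plIns (hc : c ≤ K) (w : Fin N → ℝ) (p : ℝ) :
    List.ofFn (fun t : Fin (K + 2) => soloInformedBP (soloInformedPlIns β b c) w t) =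
      soloInformedInsQ (w b) p (List.ofFn fun t : Fin (K + 1) => soloInformedBP β w t) (c + 1) := by
  apply List.ext_getElem?
  intro r
  rw [List.getElem?_ofFn, soloInformed_getElem?_insQ _ _ _ _ _ (by simp; omega)]
  by_cases hr : r < K + 2
  · rw [dif_pos hr, soloInformed_BP_plIns hb hc w (by omega : r ≤ K + 1)]
    by_cases h1 : r < c + 1
    · rw [if_pos (by omega : r ≤ c), if_pos h1, List.getElem?_ofFn, dif_pos (by omega)]
    rw [if_neg (by omega : ¬ r ≤ c), if_neg h1]
    by_cases h2 : r = c + 1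
    · rw [if_pos h2, h2, List.getD_cons_succ, List.getD_eq_getElem _ _ (by simp; omega),
        List.getElem_ofFn, Nat.add_sub_cancel]
    · rw [if_neg h2, List.getElem?_ofFn, dif_pos (by omega : r - 1 < K + 1)]
      rfl
  · rw [dif_neg hr, if_neg (by omega), if_neg (by omega), List.getElem?_ofFn, dif_neg (by omega)]
    rfl

end place

/-! ### All coordinates placed -/

section full

variable {N : ℕ} {β : Fin N → ℕ} {K : ℕ}

/-- If `cum_K = N` then every coordinate is placed (`β l ≤ K`). -/
theorem soloInformed_le_of_cum_eq (h : soloInformedCum β K = N) (l : Fin N) : β l ≤ K := by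
  have hS : Finset.univ.filter (fun l : Fin N => β l ≤ K) = Finset.univ :=
    Finset.eq_univ_of_card _ (by change soloInformedCum β K = _; rw [h, Fintype.card_fin])
  have hl : l ∈ Finset.univ.filter (fun l : Fin N => β l ≤ K) := by
    rw [hS]; exact Finset.mem_univ l
  simpa using hl

/-- **A partially valid labelling with all `N` coordinates placed is a valid block labelling.** -/
theorem soloInformed_isLab_of_cum_eq (hL : soloInformedIsLabK β K) (h : soloInformedCum β K = N) :
    soloInformedIsLab β K :=
  ⟨soloInformed_le_of_cum_eq h, hL.1, hL.2⟩

end full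

/-! ### Sanity check: two placements into the chain of `ζ(2)` with two hanging coordinates

`N = 4`, coordinates `x₀, x₁` (block `0`) and `b₁ = 2`, `b₂ = 3` unplaced (label `4`): merging `b₂`
into block `0` and then inserting `b₁` after block `0` gives the index `(3, 1)` and the chain
`(x₀x₁b₂, x₀x₁b₂b₁)`. -/

example :
    let β₀ : Fin 4 → ℕ := fun l => if l.1 < 2 then 0 else 4
    let β₁ := soloInformedPlMerge β₀ 3 0
    let β₂ := soloInformedPlIns β₁ 2 0
    soloInformedIdx β₂ 2 = [3, 1] := by
  decide

end Summit.KontsevichZagierPeriods.KontsevichZagierPeriods.Theorems
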